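import Literature.Analysis.FluidPDE.AxisymmetricL3OffAxis
import Summits.NavierStokesRegularity.NavierStokesRegularity.Theorems.CertifiedBlowupCertifiedBlowupAxisymBlowupSwirlPersists
import HarnessLib

/-!
# Off-axis points of a witness of the crux are regular at the lifespan

Summit `NavierStokesRegularity`, thesis `CertifiedBlowup`, crux
`CertifiedBlowupAxisymBlowup` (line `compact-amplification`): a witness is a maximal Leray–Hopf
classical solution `(u, p)` of the unforced Navier–Stokes system on `ℝ³ × [0, T)` of finite
lifespan `T`, launched by a rapidly decaying axisymmetric datum. This file records a piece of the
NECESSARY STRUCTURE of any witness: every point `(T, x₀)` OFF the axis of symmetry is a regular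
point — `u` is bounded on a backward parabolic neighbourhood `(T - r², T) × B(x₀, r)` of it
(`IsBoundedNearTop u T x₀`). This is the classical observation of Caffarelli–Kohn–Nirenberg type
that the singular points of axisymmetric flows of finite dissipation lie on the axis
(Seregin–Šverák 2009, §3, arXiv p. 9: "all singular points must belong to the axis of symmetry"),
WITHOUT any Type I hypothesis.

The tree proves exactly this conclusion for the standing hypotheses `AxisymmetricL3Hyp ν T u p`
(`ν > 0`, `T > 0`, classical on `[0, T)`, Leray–Hopf on `[0, T)` from `u 0`, bounded on every
closed sub-slab `[0, T']`, `T' < T`, axisymmetric slices; NO Type I field):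
`axisymmetricL3_boundedNearTop_offAxis` (`AxisymmetricL3OffAxis.lean`; rotation packing of the
dissipation, vanishing dissipation tails, viscosity-normalising parabolic rescaling about
`(T, x₀)`, Seregin's backward ε-regularity criterion `seregin2014_thm14_holds`, with `u ∈ L³` and
the gauged Riesz pressure in `L^{3/2}` of backward cylinders touching `T` from the Leray–Hopf
energy class, `AxisymmetricL3PressureBounds.lean`). For the hypotheses of the crux the two
non-literal fields are supplied by `bounded_before_of_lerayHopf_classical` (velocity bound on the
closed sub-slabs) and `isAxisymmetric_slice_of_lerayHopf_classical` (axisymmetric slices), both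
from `CertifiedBlowupCertifiedBlowupAxisymBlowupSwirlPersists.lean`.

No new definitions, no named-fact hypotheses, no `sorry`.

## References

* G. Seregin, V. Šverák, Comm. PDE 34 (2009) = arXiv:0804.1803, §3 (p. 9). [SereginSverak2009]
* L. Caffarelli, R. Kohn, L. Nirenberg, Comm. Pure Appl. Math. 35 (1982), Prop. 2 / Thm. B.
  [CaffarelliKohnNirenberg1982]
* G. Seregin, *Lecture Notes on Regularity Theory for the Navier–Stokes Equations*, World
  Scientific 2014, Ch. 6, §6.1, Thm. 1.4. [Seregin2014]
-/

-- the summit and its single problem share the name (D-0017 nested layout)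
set_option linter.dupNamespace false

noncomputable section

open MeasureTheory Set Function Filter Topology Metric
open scoped ENNReal NNReal

namespace Summit.NavierStokesRegularity.NavierStokesRegularity.Theorems.CertifiedBlowupAxisymBlowup.CompactAmplification

open Literature.Analysis.FluidPDE

/-- **Off-axis points of a witness are regular at the lifespan.** For `ν > 0`, `T > 0` and a
classical solution `(u, p)` of the unforced Navier–Stokes system on `ℝ³ × [0, T)` which is
Leray–Hopf on `[0, T)` from a rapidly decaying axisymmetric datum `u 0`, every point `x₀` off
the axis (`cylRadius x₀ ≠ 0`) is a point of local boundedness at the final time: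
`∃ r > 0, ∃ K, ∀ t ∈ (T - r², T), ∀ x ∈ B(x₀, r), ‖u t x‖ ≤ K` (Seregin–Šverák 2009, §3: the
singular points of axisymmetric suitable weak solutions of finite dissipation lie on the axis;
no Type I hypothesis). Proof: the hypotheses form an `AxisymmetricL3Hyp ν T u p` (sub-slab
bounds and axisymmetric slices by `bounded_before_of_lerayHopf_classical`,
`isAxisymmetric_slice_of_lerayHopf_classical`), to which the tree's
`axisymmetricL3_boundedNearTop_offAxis` applies. [cite: SereginSverak2009, §3 (arXiv p. 9)] -/
theorem isBoundedNearTop_of_cylRadius_ne_zero : ∀ {ν T : ℝ} {u : ℝ → EuclideanSpace ℝ (Fin 3) → EuclideanSpace ℝ (Fin 3)} {p : ℝ → EuclideanSpace ℝ (Fin 3) → ℝ}, 0 < ν → 0 < T → IsClassicalNSSolutionOn (Set.Ico 0 T) ν 0 u p → IsLerayHopfOn T ν 0 (u 0) u → HasRapidSpatialDecay (u 0) → IsAxisymmetric (u 0) → ∀ x₀ : EuclideanSpace ℝ (Fin 3), cylRadius x₀ ≠ 0 → IsBoundedNearTop u T x₀ := by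
  intro ν T u p hν hT hcl hLH hdec haxi x₀ hx₀
  have H : AxisymmetricL3Hyp ν T u p :=
    ⟨hν, hT, hcl, hLH, bounded_before_of_lerayHopf_classical hν hcl hLH hdec haxi,
      isAxisymmetric_slice_of_lerayHopf_classical hν hcl hLH hdec haxi⟩
  exact axisymmetricL3_boundedNearTop_offAxis H x₀ hx₀

end Summit.NavierStokesRegularity.NavierStokesRegularity.Theorems.CertifiedBlowupAxisymBlowup.CompactAmplification

end
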